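import Summits.Ventures.Crystal3D.Theorems.StickyWulffConstantNoReconstructionGainPredSlotBudgetRaisedThreePlanar
import Summits.Ventures.Crystal3D.Theorems.StickyWulffConstantNoReconstructionGainPredSlotBudgetRaisedThreeTangent
import HarnessLib

/-!
# Raised up bond, three contacts: the two-cap covering template and the pole-cap zone

HONEST FRAMING. Part of the venture `Summits/Ventures/Crystal3D` (cell `crystal3d-full`), helper
`--supports` the crux `NoReconstructionGain` (stmt-Ventures-19144, route
`route-Ventures-StickyWulffConstant`), line `adhesion` (wulff-p1 g15).  Generic real-variable bricks for
regime II (`(b+c)² < 2`) of the last Hall system of B1b₃ (`predSlotBudget_of_upBond_raised_three`,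
skeleton v21), in the tangent-plane language of `…RaisedThreeTangent` (`Q(X,Y) = 2 X·Y − (X·n)(Y·n)`,
`ar(X,Y) = det[X,Y,n]`, frame `|n|² = 2`, contacts `|U|² = 2` of depth `d = U·n`):
* `parseval_nuv` — Parseval in the frame `(n, u′, n × U)` (ring identity);
* `twoCap_false` — the covering template: a contact whose meridian plane strictly separates the two
  lens vertices `P, P′` of a corner cap `C` and the pole cap `W` (`C·W = 1`, `W` on the `T₀`-circle),
  and which satisfies the corner condition (M1), lies in one of the two caps (reduction to
  `planar_core` of `…RaisedThreePlanar`);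
* `poleCap_false` — a contact of depth `> T₀` within azimuth `g₀` of the pole cap centre `W` lies in
  that cap (`φ(d) = 4(d − T₀)(T₀(3 − T₀²) − d) > 0`).

WHAT THIS IS NOT: the cone/pair step (`…RaisedThreeCone`), the frame-specific inequalities in `(a,b,c)`
and the assembly;
rung F-C1 not moved.
-/

namespace Summit.Ventures.Crystal3D.Theorems

/-- **Parseval in the frame `(n, u′, ν)`** with `u′ = |n|² U − (U·n) n`, `ν = n × U`, `V = |ν|²`:
`|n|² V (Y·Z) = V (Y·n)(Z·n) + (Y·u′)(Z·u′) + |n|² (Y·ν)(Z·ν)`. -/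
theorem parseval_nuv (a b c x y z e f g p q r : ℝ) :
    (a ^ 2 + b ^ 2 + c ^ 2) * ((a ^ 2 + b ^ 2 + c ^ 2) * (x ^ 2 + y ^ 2 + z ^ 2) - (a * x + b * y + c * z) ^ 2) *
      (e * p + f * q + g * r) =
    ((a ^ 2 + b ^ 2 + c ^ 2) * (x ^ 2 + y ^ 2 + z ^ 2) - (a * x + b * y + c * z) ^ 2) *
      (e * a + f * b + g * c) * (p * a + q * b + r * c) +
    (e * ((a ^ 2 + b ^ 2 + c ^ 2) * x - (a * x + b * y + c * z) * a) +
      f * ((a ^ 2 + b ^ 2 + c ^ 2) * y - (a * x + b * y + c * z) * b) +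
      g * ((a ^ 2 + b ^ 2 + c ^ 2) * z - (a * x + b * y + c * z) * c)) *
    (p * ((a ^ 2 + b ^ 2 + c ^ 2) * x - (a * x + b * y + c * z) * a) +
      q * ((a ^ 2 + b ^ 2 + c ^ 2) * y - (a * x + b * y + c * z) * b) +
      r * ((a ^ 2 + b ^ 2 + c ^ 2) * z - (a * x + b * y + c * z) * c)) +
    (a ^ 2 + b ^ 2 + c ^ 2) * (e * (b * z - c * y) + f * (c * x - a * z) + g * (a * y - b * x)) *
      (p * (b * z - c * y) + q * (c * x - a * z) + r * (a * y - b * x)) := by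
  ring


/-- **Two-cap covering (geometric template).**  Frame `n = (a,b,c)` (`|n|² = 2`), contact `U = (x,y,z)`
(`|U|² = 2`, depth `d`), pole cap centre `W` (`|W|² = 2`, depth `T₀ > 1`, `T₀ < d`) and corner cap centre
`C` (depth `d_C ≥ 0`), tangent components `k_C = U·C − d d_C/2`, `k_W = U·W − d T₀/2`; lens vertices
`P, P′` of the two caps (`P·C = P·W = P′·C = P′·W = 1`, `|P|² = |P′|² = 2`, `P·P′ < 2`) strictly
separated by the meridian plane `span(n, U)` (`hsep`, with `ν = n × U`); and the corner condition (M1)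
`(2 − T₀ d_C)²(4 − d²) < (2k_C)²(4 − T₀²)`, `k_C > 0`.  Then `U` blocks `C` or `W` — contradiction with
`U·C ≤ 1`, `U·W ≤ 1`.  (Reduction to `planar_core` through the Parseval frame `(n, u′, n × U)`.) -/
theorem twoCap_false {a b c x y z c₁ c₂ c₃ w₁ w₂ w₃ p₁ p₂ p₃ q₁ q₂ q₃ d T₀ dC kC kW : ℝ}
    (hn : a ^ 2 + b ^ 2 + c ^ 2 = 2) (hu : x ^ 2 + y ^ 2 + z ^ 2 = 2) (hW2 : w₁ ^ 2 + w₂ ^ 2 + w₃ ^ 2 = 2)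
    (hd : a * x + b * y + c * z = d) (hT : a * w₁ + b * w₂ + c * w₃ = T₀) (hC : a * c₁ + b * c₂ + c * c₃ = dC)
    (hkC : x * c₁ + y * c₂ + z * c₃ = d * dC / 2 + kC) (hkW : x * w₁ + y * w₂ + z * w₃ = d * T₀ / 2 + kW)
    (hT0 : 1 < T₀) (hdT : T₀ < d) (hdC : 0 ≤ dC)
    (hUC : d * dC / 2 + kC ≤ 1) (hUW : d * T₀ / 2 + kW ≤ 1)
    (hkC0 : 0 < kC) (hM1 : (2 - T₀ * dC) ^ 2 * (4 - d ^ 2) < (2 * kC) ^ 2 * (4 - T₀ ^ 2))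
    (hPC : p₁ * c₁ + p₂ * c₂ + p₃ * c₃ = 1) (hPW : p₁ * w₁ + p₂ * w₂ + p₃ * w₃ = 1)
    (hQC : q₁ * c₁ + q₂ * c₂ + q₃ * c₃ = 1) (hQW : q₁ * w₁ + q₂ * w₂ + q₃ * w₃ = 1)
    (hP2 : p₁ ^ 2 + p₂ ^ 2 + p₃ ^ 2 = 2) (hQ2 : q₁ ^ 2 + q₂ ^ 2 + q₃ ^ 2 = 2)
    (hPQ : p₁ * q₁ + p₂ * q₂ + p₃ * q₃ < 2)
    (hsep : (p₁ * (b * z - c * y) + p₂ * (c * x - a * z) + p₃ * (a * y - b * x)) *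
      (q₁ * (b * z - c * y) + q₂ * (c * x - a * z) + q₃ * (a * y - b * x)) < 0) : False := by
  obtain ⟨sP, hsP⟩ : ∃ s, s = p₁ * (b * z - c * y) + p₂ * (c * x - a * z) + p₃ * (a * y - b * x) := ⟨_, rfl⟩
  obtain ⟨sQ, hsQ⟩ : ∃ s, s = q₁ * (b * z - c * y) + q₂ * (c * x - a * z) + q₃ * (a * y - b * x) := ⟨_, rfl⟩
  rw [← hsP, ← hsQ] at hsep
  -- `d < 2`
  have hd2 : d < 2 := by
    have CS : ((a - x) * w₁ + (b - y) * w₂ + (c - z) * w₃) ^ 2 ≤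
        ((a - x) ^ 2 + (b - y) ^ 2 + (c - z) ^ 2) * (w₁ ^ 2 + w₂ ^ 2 + w₃ ^ 2) := by
      nlinarith only [sq_nonneg ((a - x) * w₂ - (b - y) * w₁), sq_nonneg ((a - x) * w₃ - (c - z) * w₁),
        sq_nonneg ((b - y) * w₃ - (c - z) * w₂)]
    have e1 : (a - x) ^ 2 + (b - y) ^ 2 + (c - z) ^ 2 = 4 - 2 * d := by linear_combination hn + hu - 2 * hd
    have e2 : (a - x) * w₁ + (b - y) * w₂ + (c - z) * w₃ = T₀ - (d * T₀ / 2 + kW) := by linear_combination hT - hkW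
    rw [e1, hW2, e2] at CS
    have hpos : 0 < T₀ - (d * T₀ / 2 + kW) := by linarith
    nlinarith only [CS, hpos, mul_pos hpos hpos]
  have hr : 0 < 4 - d ^ 2 := by nlinarith only [hd2, hdT, hT0]
  -- separation
  have hS2 : 0 < (sP - sQ) ^ 2 := by
    have : sP - sQ ≠ 0 := by
      intro h
      have : sP = sQ := by linarith
      rw [this] at hsep; nlinarith only [hsep, sq_nonneg sQ]
    positivity
  have hSne : sP - sQ ≠ 0 := by intro h; rw [h] at hS2; simp at hS2
  -- the apex vector `X̃ = sP • P′ − sQ • P`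
  have XC : (sP * q₁ - sQ * p₁) * c₁ + (sP * q₂ - sQ * p₂) * c₂ + (sP * q₃ - sQ * p₃) * c₃ = sP - sQ := by
    linear_combination sP * hQC - sQ * hPC
  have XW : (sP * q₁ - sQ * p₁) * w₁ + (sP * q₂ - sQ * p₂) * w₂ + (sP * q₃ - sQ * p₃) * w₃ = sP - sQ := by
    linear_combination sP * hQW - sQ * hPW
  have Xν : (sP * q₁ - sQ * p₁) * (b * z - c * y) + (sP * q₂ - sQ * p₂) * (c * x - a * z) +
      (sP * q₃ - sQ * p₃) * (a * y - b * x) = 0 := by rw [hsP, hsQ]; ring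
  have Xnorm : (sP * q₁ - sQ * p₁) ^ 2 + (sP * q₂ - sQ * p₂) ^ 2 + (sP * q₃ - sQ * p₃) ^ 2 < 2 * (sP - sQ) ^ 2 := by
    have e : 2 * (sP - sQ) ^ 2 - ((sP * q₁ - sQ * p₁) ^ 2 + (sP * q₂ - sQ * p₂) ^ 2 + (sP * q₃ - sQ * p₃) ^ 2) =
        -2 * (sP * sQ) * (2 - (p₁ * q₁ + p₂ * q₂ + p₃ * q₃)) := by
      linear_combination (-sQ ^ 2) * hP2 - sP ^ 2 * hQ2
    nlinarith only [e, mul_pos (by linarith : 0 < -2 * (sP * sQ)) (by linarith : 0 < 2 - (p₁ * q₁ + p₂ * q₂ + p₃ * q₃))]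
  -- Parseval decompositions of `X̃·C`, `X̃·W`, `|X̃|²`
  obtain ⟨Xn, hXn⟩ : ∃ s, s = (sP * q₁ - sQ * p₁) * a + (sP * q₂ - sQ * p₂) * b + (sP * q₃ - sQ * p₃) * c := ⟨_, rfl⟩
  obtain ⟨Xu, hXu⟩ : ∃ s, s = (sP * q₁ - sQ * p₁) * (2 * x - d * a) + (sP * q₂ - sQ * p₂) * (2 * y - d * b) +
      (sP * q₃ - sQ * p₃) * (2 * z - d * c) := ⟨_, rfl⟩
  have hV : (a ^ 2 + b ^ 2 + c ^ 2) * (x ^ 2 + y ^ 2 + z ^ 2) - (a * x + b * y + c * z) ^ 2 = 4 - d ^ 2 := by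
    rw [hn, hu, hd]; ring
  have parC := parseval_nuv a b c x y z (sP * q₁ - sQ * p₁) (sP * q₂ - sQ * p₂) (sP * q₃ - sQ * p₃) c₁ c₂ c₃
  have parW := parseval_nuv a b c x y z (sP * q₁ - sQ * p₁) (sP * q₂ - sQ * p₂) (sP * q₃ - sQ * p₃) w₁ w₂ w₃
  have parX := parseval_nuv a b c x y z (sP * q₁ - sQ * p₁) (sP * q₂ - sQ * p₂) (sP * q₃ - sQ * p₃)
    (sP * q₁ - sQ * p₁) (sP * q₂ - sQ * p₂) (sP * q₃ - sQ * p₃)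
  rw [hV, hn, hd] at parC parW parX
  have eCu : c₁ * (2 * x - d * a) + c₂ * (2 * y - d * b) + c₃ * (2 * z - d * c) = 2 * kC := by
    linear_combination 2 * hkC - d * hC
  have eWu : w₁ * (2 * x - d * a) + w₂ * (2 * y - d * b) + w₃ * (2 * z - d * c) = 2 * kW := by
    linear_combination 2 * hkW - d * hT
  have eCn : c₁ * a + c₂ * b + c₃ * c = dC := by linear_combination hC
  have eWn : w₁ * a + w₂ * b + w₃ * c = T₀ := by linear_combination hT
  rw [XC, Xν, eCu, eCn, ← hXn, ← hXu] at parC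
  rw [XW, Xν, eWu, eWn, ← hXn, ← hXu] at parW
  rw [Xν, ← hXn, ← hXu] at parX
  -- parC : 2 * (4 - d²) * (sP - sQ) = (4 - d²) * Xn * dC + Xu * (2 kC) + 2 * 0 * ..
  have hkne : kC ≠ 0 := ne_of_gt hkC0
  have hden1 : 2 * (sP - sQ) ≠ 0 := mul_ne_zero two_ne_zero hSne
  have hden2 : (4 - d ^ 2) * (sP - sQ) ≠ 0 := mul_ne_zero (ne_of_gt hr) hSne
  obtain ⟨βC, hβC⟩ : ∃ s : ℝ, s * kC = 1 - T₀ * dC / 2 := ⟨(1 - T₀ * dC / 2) / kC, div_mul_cancel₀ _ hkne⟩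
  obtain ⟨αX, hαX⟩ : ∃ s : ℝ, s * (2 * (sP - sQ)) = Xn := ⟨Xn / (2 * (sP - sQ)), div_mul_cancel₀ _ hden1⟩
  obtain ⟨βX, hβX⟩ : ∃ s : ℝ, s * ((4 - d ^ 2) * (sP - sQ)) = Xu :=
    ⟨Xu / ((4 - d ^ 2) * (sP - sQ)), div_mul_cancel₀ _ hden2⟩
  have hkC2 : 0 < kC ^ 2 := by positivity
  have hS4 : 0 < 2 * (4 - d ^ 2) * (sP - sQ) ^ 2 := by positivity
  refine planar_core (T₀ := T₀) (d := d) (dC := dC) (kC := kC) (kW := kW) (r2 := (4 - d ^ 2) / 2)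
    (βC := βC) (αX := αX) (βX := βX) hT0 hdT hdC hkC0 (by positivity) (by ring) hUC hUW (by linarith) ?_ ?_ ?_ ?_
  · -- `V_C` inside the disk, from (M1)
    by_contra h
    push Not at h
    have hb2 : βC ^ 2 * kC ^ 2 = (1 - T₀ * dC / 2) ^ 2 := by rw [← hβC]; ring
    have hb3 : βC ^ 2 * kC ^ 2 * d ^ 2 = (1 - T₀ * dC / 2) ^ 2 * d ^ 2 := by rw [hb2]
    nlinarith only [mul_le_mul_of_nonneg_left h hkC2.le, hb2, hb3, hM1, hkC2]
  · have e : (αX * dC + βX * kC) * (2 * (4 - d ^ 2) * (sP - sQ)) = 1 * (2 * (4 - d ^ 2) * (sP - sQ)) := by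
      linear_combination (dC * (4 - d ^ 2)) * hαX + (2 * kC) * hβX - parC
    exact mul_right_cancel₀ (mul_ne_zero (mul_ne_zero two_ne_zero (ne_of_gt hr)) hSne) e
  · have e : (αX * T₀ + βX * kW) * (2 * (4 - d ^ 2) * (sP - sQ)) = 1 * (2 * (4 - d ^ 2) * (sP - sQ)) := by
      linear_combination (T₀ * (4 - d ^ 2)) * hαX + (2 * kW) * hβX - parW
    exact mul_right_cancel₀ (mul_ne_zero (mul_ne_zero two_ne_zero (ne_of_gt hr)) hSne) e
  · by_contra h
    push Not at h
    have ha2 : αX ^ 2 * (sP - sQ) ^ 2 * 4 = Xn ^ 2 := by rw [← hαX]; ring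
    have ha3 : αX ^ 2 * (sP - sQ) ^ 2 * 4 * d ^ 2 = Xn ^ 2 * d ^ 2 := by rw [ha2]
    have hb2 : βX ^ 2 * (4 - d ^ 2) ^ 2 * (sP - sQ) ^ 2 = Xu ^ 2 := by rw [← hβX]; ring
    nlinarith only [mul_le_mul_of_nonneg_left h hS4.le, ha2, ha3, hb2, parX, Xnorm, hr, hS2]

/-- **Pole-cap zone.**  A contact `U` of depth `d > T₀` (`1 < T₀`, `T₀² < 2`) whose tangent part is
within azimuth `g₀` of that of the pole-cap centre `W` (`|W|² = 2`, depth `T₀`; the hypothesis is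
`Q(U,W) ≥ 0 ∧ Q(U,W)²(4 − T₀²) ≥ (2 − T₀²)²(4 − d²)`) lies in the cap: contradiction with `U·W ≤ 1`.
Key polynomial: `(2 − T₀²)²(4 − d²) − (4 − T₀²)(2 − dT₀)² = 4(d − T₀)(T₀(3 − T₀²) − d)`. -/
theorem poleCap_false {a b c x y z w₁ w₂ w₃ d T₀ : ℝ} (hn : a ^ 2 + b ^ 2 + c ^ 2 = 2)
    (hu : x ^ 2 + y ^ 2 + z ^ 2 = 2) (hd : a * x + b * y + c * z = d)
    (hT0 : 1 < T₀) (hT2 : T₀ ^ 2 < 2) (hdT : T₀ < d)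
    (hUW : x * w₁ + y * w₂ + z * w₃ ≤ 1) (hQ : 0 ≤ 2 * (x * w₁ + y * w₂ + z * w₃) - d * T₀)
    (haz : (2 - T₀ ^ 2) ^ 2 * (4 - d ^ 2) ≤ (2 * (x * w₁ + y * w₂ + z * w₃) - d * T₀) ^ 2 * (4 - T₀ ^ 2)) :
    False := by
  have hd2 : d ≤ 2 := by nlinarith only [sq_nonneg (a - x), sq_nonneg (b - y), sq_nonneg (c - z), hn, hu, hd]
  obtain ⟨q, hq⟩ : ∃ s, s = 2 * (x * w₁ + y * w₂ + z * w₃) - d * T₀ := ⟨_, rfl⟩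
  rw [← hq] at hQ haz
  have hq1 : q ≤ 2 - d * T₀ := by rw [hq]; linarith
  rcases le_or_gt 2 (d * T₀) with hbig | hsmall
  · -- `d T₀ ≥ 2`: then `q = 0`, so `(2 - T₀²)²(4 - d²) ≤ 0`, `d = 2`, `T₀ ≤ 1`
    have hq0 : q = 0 := le_antisymm (by linarith) hQ
    rw [hq0] at haz
    have h4 : 4 - d ^ 2 ≤ 0 := by
      by_contra h
      push Not at h
      nlinarith only [haz, h, hT2, mul_pos (mul_pos (sub_pos.2 hT2) (sub_pos.2 hT2)) h]
    have hUW' : d * T₀ ≤ 2 := by rw [hq] at hq0; linarith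
    have hdT2 : d * T₀ = 2 := le_antisymm hUW' hbig
    have hd4 : d ^ 2 = 4 := by
      nlinarith only [h4, hd2, mul_nonneg (sub_nonneg.2 hd2) (by linarith : (0:ℝ) ≤ d + 2)]
    have h' : d ^ 2 * T₀ ^ 2 = 4 := by rw [← mul_pow, hdT2]; norm_num
    rw [hd4] at h'
    nlinarith only [h', hT0]
  · have phi : (2 - T₀ ^ 2) ^ 2 * (4 - d ^ 2) - (4 - T₀ ^ 2) * (2 - d * T₀) ^ 2 =
        4 * (d - T₀) * (T₀ * (3 - T₀ ^ 2) - d) := by ring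
    have hpos : 0 < 4 * (d - T₀) * (T₀ * (3 - T₀ ^ 2) - d) := by
      have h1 : 0 < d - T₀ := sub_pos.2 hdT
      have h2 : 0 < T₀ * (3 - T₀ ^ 2) - d := by
        -- `T₀(3 - T₀²) - d ≥ T₀(3 - T₀²) - 2/T₀ = -(T₀² - 1)(T₀² - 2)/T₀ > 0`
        have hT : 0 < T₀ := by linarith
        have key : 0 < T₀ * (T₀ * (3 - T₀ ^ 2)) - 2 := by nlinarith only [hT0, hT2, mul_pos (sub_pos.2 hT0) (sub_pos.2 hT2)]
        nlinarith only [key, hsmall, hT]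
      positivity
    have hq2 : q ^ 2 ≤ (2 - d * T₀) ^ 2 := by nlinarith only [hQ, hq1]
    have h4T : 0 < 4 - T₀ ^ 2 := by nlinarith only [hT2]
    nlinarith only [haz, phi, hpos, mul_le_mul_of_nonneg_left hq2 h4T.le]

end Summit.Ventures.Crystal3D.Theorems
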